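import Summits.Ventures.GridStability.Models.InverterDVOCNetwork

/-!
# GridStability/Models/InverterDVOCQuotient — rotation invariants of the dVOC network and the QUOTIENT dynamics (target statement for rung G3.c, N = 2)

Cell `gridfusion` (LADDER-GRIDFUSION, APEX LINE rung G3.c «dVOC network», director RULING 16 (c):
«model-3 writes the TARGET STATEMENT now (orbit-set / relative-coordinate certificate: quotient by
the common rotation, or V built from rotation invariants `|v_i|²`, `⟨v_i, v_j⟩`, `v_i ∧ v_j`)»;
seat model-3; `plan/PARTITION.md` §0 row `Models/`). THREE COLUMNS: MODELLED column — exact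
algebra on the typed reduced dVOC network `InverterDVOC.DvocNetwork` (p465594,
[cite: SuboticEtAl2021, §VI-C eq. (ss.f.vhat)]); no stability claim, no certificate.

## The point

`f^s_v̂` is rotation-equivariant (`DvocNetwork.field_rotate`), so its rest points are circles and a
Lyapunov certificate «`z(t) → z⋆`» is impossible in the static frame. The invariants of the diagonal
`SO(2)` action on `(ℝ²)^N` — `ρ_k = ‖v̂_k‖²`, `ξ_kj = ⟨v̂_k, v̂_j⟩`, `ζ_kj = v̂_k ∧ v̂_j` (§1, proved
invariant in `rho_rotate`, `xi_rotate`, `zeta_rotate`, with the syzygy `ξ_kj² + ζ_kj² = ρ_k ρ_j`) —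
separate orbits, and because `f^s` is equivariant their Lie derivatives are again invariant, hence
polynomial in the invariants. §2 computes this QUOTIENT VECTOR FIELD for `N = 2` explicitly
(`quotRho0`, `quotRho1`, `quotXi`, `quotZeta`, kernel-checked identities `lie_rho0`, `lie_rho1`,
`lie_xi`, `lie_zeta`): a polynomial field of DEGREE 2 in the four variables `(ρ₀, ρ₁, ξ, ζ)` on the
quadric `{ξ² + ζ² = ρ₀ρ₁}` — coefficients rational in `(η, η_a, p_k*, q_k*, 1/v_k*², Yre, Yim)` and
in `(cos κ, sin κ)` (PROVENANCE P-INV-5: `κ = tan⁻¹(ω₀ρ)` makes these irrational for generic line data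
⇒ A1-style rational circle point `κ′`, declared). §3 transports solutions: along every solution of
`f^s_v̂` the invariant 4-vector solves the quotient ODE (`hasDerivWithinAt_invariants`).

## TARGET STATEMENT (rung G3.c, one `N = 2` attempt by sos-3; soundness by lyap-1's layer verbatim)

Produce `(V, c, ε)` — `V` a polynomial in `r = (ρ₀, ρ₁, ξ, ζ)`, rest point `r⋆` of the quotient field
(at the operating point: `ρ_k⋆ = v_k*²`, `(ξ⋆, ζ⋆) = v₀* v₁* (cos θ₀₁⋆, sin θ₀₁⋆)`, rational by A1 on
`θ₀₁⋆` and `κ′`) shifted to the origin — with the Bench identities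
`V − ε|r − r⋆|² ≥ 0` on `{ξ² + ζ² = ρ₀ρ₁}` and `−∇V·G − ε|r − r⋆|² ≥ 0` on
`{ξ² + ζ² = ρ₀ρ₁} ∩ {V ≤ c}` (`G` = `quot*` below; 4 variables, 1 equality multiplier, field degree 2
⇒ Gram basis 15 at `V`-degree 2, 35 at degree 4 — inside one `decide`). CONCLUSION SHAPE (via
`Lyapunov.CertificateSoundness.certificate_invariance_tendsto` on `ℝ⁴` with `M` = the quadric and
§3 for hypothesis (4)): for every solution `v̂` of `f^s_v̂` on `[0, ∞)` with `V(r(0)) ≤ c`: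
`V(r(t)) ≤ c` for all `t ≥ 0` and `r(t) → r⋆`, i.e. `v̂(t)` converges to the ORBIT
`{ρ_k = v_k*², ξ = ξ⋆, ζ = ζ⋆}` — the set `𝒳^s`-type statement of [cite: SuboticEtAl2021, Thm. 6]
for the reduced model, as a certified inner estimate. MODELLED: MV-6O.
-/

noncomputable section

open Real Finset

namespace Summit.Ventures.GridStability.Models.InverterDVOC.DvocNetwork

variable {N : ℕ} (W : DvocNetwork N)

/-! ## §1 Rotation invariants and the syzygy -/

/-- Squared voltage magnitude `ρ_k = ‖v̂_k‖² = x_k² + y_k²`. -/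
def rho (v : State N) (k : Fin N) : ℝ := v.1 k ^ 2 + v.2 k ^ 2

/-- Inner product `ξ_kj = ⟨v̂_k, v̂_j⟩ = x_k x_j + y_k y_j` (`= ‖v̂_k‖‖v̂_j‖ cos θ_kj`). -/
def xi (v : State N) (k j : Fin N) : ℝ := v.1 k * v.1 j + v.2 k * v.2 j

/-- Wedge `ζ_kj = v̂_k ∧ v̂_j = x_k y_j − y_k x_j` (`= ‖v̂_k‖‖v̂_j‖ sin θ_kj`, `θ_kj` = angle from
`v̂_k` to `v̂_j`). -/
def zeta (v : State N) (k j : Fin N) : ℝ := v.1 k * v.2 j - v.2 k * v.1 j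

/-- The syzygy of the `SO(2)` invariants: `ξ_kj² + ζ_kj² = ρ_k ρ_j` (Lagrange identity) — the ONE
equality constraint of the quotient system. -/
theorem syzygy (v : State N) (k j : Fin N) :
    xi v k j ^ 2 + zeta v k j ^ 2 = rho v k * rho v j := by
  simp only [xi, zeta, rho]; ring

/-- `ρ_k` is invariant under the global rotation `ℛ(θ)`. -/
theorem rho_rotate (θ : ℝ) (v : State N) (k : Fin N) : rho (rotate θ v) k = rho v k := by
  have sc := sin_sq_add_cos_sq θ
  simp only [rho, rotate]
  linear_combination (v.1 k ^ 2 + v.2 k ^ 2) * sc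

/-- `ξ_kj` is invariant under the global rotation. -/
theorem xi_rotate (θ : ℝ) (v : State N) (k j : Fin N) : xi (rotate θ v) k j = xi v k j := by
  have sc := sin_sq_add_cos_sq θ
  simp only [xi, rotate]
  linear_combination (v.1 k * v.1 j + v.2 k * v.2 j) * sc

/-- `ζ_kj` is invariant under the global rotation. -/
theorem zeta_rotate (θ : ℝ) (v : State N) (k j : Fin N) : zeta (rotate θ v) k j = zeta v k j := by
  have sc := sin_sq_add_cos_sq θ
  simp only [zeta, rotate]
  linear_combination (v.1 k * v.2 j - v.2 k * v.1 j) * sc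

/-! ## §2 The quotient vector field for `N = 2` -/

section TwoConverters

variable (W : DvocNetwork 2)

/-- Real part of the `(k, j)` block of `ℛ(κ) 𝒴`: `A_kj = cos κ · Yre_kj − sin κ · Yim_kj`. -/
def blkA (k j : Fin 2) : ℝ := cos W.κ * W.Yre k j - sin W.κ * W.Yim k j

/-- Imaginary (`J`) part of the `(k, j)` block of `ℛ(κ) 𝒴`: `B_kj = cos κ · Yim_kj + sin κ · Yre_kj`. -/
def blkB (k j : Fin 2) : ℝ := cos W.κ * W.Yim k j + sin W.κ * W.Yre k j

/-- Real part of `K_k = (1/v_k*²) R(κ)(p_k* I − q_k* J)`: `P_k = (cos κ p_k* + sin κ q_k*)/v_k*²`. -/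
def gainP (k : Fin 2) : ℝ := (cos W.κ * W.pref k + sin W.κ * W.qref k) / W.vref k ^ 2

/-- `J` part of `K_k`: `Q_k = (sin κ p_k* − cos κ q_k*)/v_k*²`. -/
def gainQ (k : Fin 2) : ℝ := (sin W.κ * W.pref k - cos W.κ * W.qref k) / W.vref k ^ 2

/-- Quotient field, `ρ₀`-component: `ρ̇₀ = 2η [ (P₀ − A₀₀ + η_a Φ₀(ρ₀)) ρ₀ − A₀₁ ξ + B₀₁ ζ ]`,
`Φ₀(ρ₀) = 1 − ρ₀/v₀*²`. Degree 2. -/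
def quotRho0 (ρ₀ _ρ₁ ξ ζ : ℝ) : ℝ :=
  2 * W.η * ((W.gainP 0 - W.blkA 0 0 + W.ηa * (1 - ρ₀ / W.vref 0 ^ 2)) * ρ₀ - W.blkA 0 1 * ξ
    + W.blkB 0 1 * ζ)

/-- Quotient field, `ρ₁`-component: `ρ̇₁ = 2η [ (P₁ − A₁₁ + η_a Φ₁(ρ₁)) ρ₁ − A₁₀ ξ − B₁₀ ζ ]`. -/
def quotRho1 (_ρ₀ ρ₁ ξ ζ : ℝ) : ℝ :=
  2 * W.η * ((W.gainP 1 - W.blkA 1 1 + W.ηa * (1 - ρ₁ / W.vref 1 ^ 2)) * ρ₁ - W.blkA 1 0 * ξ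
    - W.blkB 1 0 * ζ)

/-- Quotient field, `ξ`-component:
`ξ̇ = η [ (P₀ + P₁ − A₀₀ − A₁₁ + η_a(Φ₀ + Φ₁)) ξ + (Q₀ − Q₁ − B₀₀ + B₁₁) ζ − A₀₁ ρ₁ − A₁₀ ρ₀ ]`. -/
def quotXi (ρ₀ ρ₁ ξ ζ : ℝ) : ℝ :=
  W.η * ((W.gainP 0 + W.gainP 1 - W.blkA 0 0 - W.blkA 1 1
      + W.ηa * ((1 - ρ₀ / W.vref 0 ^ 2) + (1 - ρ₁ / W.vref 1 ^ 2))) * ξ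
    + (W.gainQ 0 - W.gainQ 1 - W.blkB 0 0 + W.blkB 1 1) * ζ - W.blkA 0 1 * ρ₁ - W.blkA 1 0 * ρ₀)

/-- Quotient field, `ζ`-component:
`ζ̇ = η [ (P₀ + P₁ − A₀₀ − A₁₁ + η_a(Φ₀ + Φ₁)) ζ + (−Q₀ + Q₁ + B₀₀ − B₁₁) ξ + B₀₁ ρ₁ − B₁₀ ρ₀ ]`. -/
def quotZeta (ρ₀ ρ₁ ξ ζ : ℝ) : ℝ :=
  W.η * ((W.gainP 0 + W.gainP 1 - W.blkA 0 0 - W.blkA 1 1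
      + W.ηa * ((1 - ρ₀ / W.vref 0 ^ 2) + (1 - ρ₁ / W.vref 1 ^ 2))) * ζ
    + (-W.gainQ 0 + W.gainQ 1 + W.blkB 0 0 - W.blkB 1 1) * ξ + W.blkB 0 1 * ρ₁ - W.blkB 1 0 * ρ₀)

/-- **Lie derivative of `ρ₀`** along `f^s_v̂` is the quotient component:
`∇ρ₀ · f^s = 2(x₀ f₀ₓ + y₀ f₀ᵧ) = quotRho0(ρ₀, ρ₁, ξ, ζ)` — an IDENTITY in the state (kernel-checked
by `ring`; this is the I2 datum for the producer). -/
theorem lie_rho0 (v : State 2) :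
    2 * (v.1 0 * W.dv₁ v 0 + v.2 0 * W.dv₂ v 0)
      = W.quotRho0 (rho v 0) (rho v 1) (xi v 0 1) (zeta v 0 1) := by
  simp only [dv₁, dv₂, Dvoc.dv₁, Dvoc.dv₂, Dvoc.Kv₁, Dvoc.Kv₂, Dvoc.phi, unit, netCur₁, netCur₂,
    Fin.sum_univ_two, rho, xi, zeta, quotRho0, gainP, blkA, blkB]
  ring

/-- **Lie derivative of `ρ₁`** along `f^s_v̂`. -/
theorem lie_rho1 (v : State 2) :
    2 * (v.1 1 * W.dv₁ v 1 + v.2 1 * W.dv₂ v 1)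
      = W.quotRho1 (rho v 0) (rho v 1) (xi v 0 1) (zeta v 0 1) := by
  simp only [dv₁, dv₂, Dvoc.dv₁, Dvoc.dv₂, Dvoc.Kv₁, Dvoc.Kv₂, Dvoc.phi, unit, netCur₁, netCur₂,
    Fin.sum_univ_two, rho, xi, zeta, quotRho1, gainP, blkA, blkB]
  ring

/-- **Lie derivative of `ξ`** along `f^s_v̂`: `∇ξ · f^s = x₁ f₀ₓ + y₁ f₀ᵧ + x₀ f₁ₓ + y₀ f₁ᵧ = quotXi`. -/
theorem lie_xi (v : State 2) :
    v.1 1 * W.dv₁ v 0 + v.2 1 * W.dv₂ v 0 + v.1 0 * W.dv₁ v 1 + v.2 0 * W.dv₂ v 1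
      = W.quotXi (rho v 0) (rho v 1) (xi v 0 1) (zeta v 0 1) := by
  simp only [dv₁, dv₂, Dvoc.dv₁, Dvoc.dv₂, Dvoc.Kv₁, Dvoc.Kv₂, Dvoc.phi, unit, netCur₁, netCur₂,
    Fin.sum_univ_two, rho, xi, zeta, quotXi, gainP, gainQ, blkA, blkB]
  ring

/-- **Lie derivative of `ζ`** along `f^s_v̂`: `∇ζ · f^s = y₁ f₀ₓ − x₁ f₀ᵧ − y₀ f₁ₓ + x₀ f₁ᵧ = quotZeta`. -/
theorem lie_zeta (v : State 2) :
    v.2 1 * W.dv₁ v 0 - v.1 1 * W.dv₂ v 0 - v.2 0 * W.dv₁ v 1 + v.1 0 * W.dv₂ v 1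
      = W.quotZeta (rho v 0) (rho v 1) (xi v 0 1) (zeta v 0 1) := by
  simp only [dv₁, dv₂, Dvoc.dv₁, Dvoc.dv₂, Dvoc.Kv₁, Dvoc.Kv₂, Dvoc.phi, unit, netCur₁, netCur₂,
    Fin.sum_univ_two, rho, xi, zeta, quotZeta, gainP, gainQ, blkA, blkB]
  ring

/-- The quotient vector field `G : ℝ⁴ → ℝ⁴` on `r = (ρ₀, ρ₁, ξ, ζ)` (indices `0,1,2,3`). -/
def quotField (r : Fin 4 → ℝ) : Fin 4 → ℝ :=
  ![W.quotRho0 (r 0) (r 1) (r 2) (r 3), W.quotRho1 (r 0) (r 1) (r 2) (r 3),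
    W.quotXi (r 0) (r 1) (r 2) (r 3), W.quotZeta (r 0) (r 1) (r 2) (r 3)]

/-- The invariant map `v̂ ↦ r = (ρ₀, ρ₁, ξ₀₁, ζ₀₁) ∈ ℝ⁴`. -/
def invariants (v : State 2) : Fin 4 → ℝ := ![rho v 0, rho v 1, xi v 0 1, zeta v 0 1]

/-- The image of `invariants` lies on the quadric `M = {r | r₂² + r₃² = r₀ r₁}` (the recast
constraint of the quotient system, cf. `SMIB.hcon` for the angle recast). -/
theorem invariants_mem_quadric (v : State 2) :
    invariants v 2 ^ 2 + invariants v 3 ^ 2 = invariants v 0 * invariants v 1 := by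
  simp [invariants, syzygy]

/-- `invariants` is constant on `ℛ(θ)`-orbits — it descends to the quotient. -/
theorem invariants_rotate (θ : ℝ) (v : State 2) : invariants (rotate θ v) = invariants v := by
  ext i
  fin_cases i <;> simp [invariants, rho_rotate, xi_rotate, zeta_rotate]

/-! ## §3 Solutions descend: the invariant curve solves the quotient ODE -/

section Descend

variable {γ : ℝ → State 2} {s : Set ℝ} {t : ℝ}

/-- Coordinate derivatives of a solution: `x_k` has derivative `(f^s)_{k,1}`. -/
theorem hasDerivWithinAt_fst (hγ : HasDerivWithinAt γ (W.field (γ t)) s t) (k : Fin 2) :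
    HasDerivWithinAt (fun τ => (γ τ).1 k) (W.dv₁ (γ t) k) s t := by
  have h1 : HasDerivWithinAt (fun τ => (γ τ).1) (W.field (γ t)).1 s t := by
    simpa using hγ.hasFDerivWithinAt.fst.hasDerivWithinAt
  simpa [field] using (hasDerivWithinAt_pi.1 h1) k

/-- Coordinate derivatives of a solution: `y_k` has derivative `(f^s)_{k,2}`. -/
theorem hasDerivWithinAt_snd (hγ : HasDerivWithinAt γ (W.field (γ t)) s t) (k : Fin 2) :
    HasDerivWithinAt (fun τ => (γ τ).2 k) (W.dv₂ (γ t) k) s t := by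
  have h2 : HasDerivWithinAt (fun τ => (γ τ).2) (W.field (γ t)).2 s t := by
    simpa using hγ.hasFDerivWithinAt.snd.hasDerivWithinAt
  simpa [field] using (hasDerivWithinAt_pi.1 h2) k

/-- Along a solution, `ρ₀` obeys the quotient equation `ρ̇₀ = quotRho0(r)`. -/
theorem hasDerivWithinAt_rho0 (hγ : HasDerivWithinAt γ (W.field (γ t)) s t) :
    HasDerivWithinAt (fun τ => rho (γ τ) 0)
      (W.quotRho0 (rho (γ t) 0) (rho (γ t) 1) (xi (γ t) 0 1) (zeta (γ t) 0 1)) s t := by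
  have key : HasDerivWithinAt (fun τ => (γ τ).1 0 * (γ τ).1 0 + (γ τ).2 0 * (γ τ).2 0)
      (W.dv₁ (γ t) 0 * (γ t).1 0 + (γ t).1 0 * W.dv₁ (γ t) 0
        + (W.dv₂ (γ t) 0 * (γ t).2 0 + (γ t).2 0 * W.dv₂ (γ t) 0)) s t :=
    ((W.hasDerivWithinAt_fst hγ 0).mul (W.hasDerivWithinAt_fst hγ 0)).add
      ((W.hasDerivWithinAt_snd hγ 0).mul (W.hasDerivWithinAt_snd hγ 0))
  have hf : (fun τ => rho (γ τ) 0) = fun τ => (γ τ).1 0 * (γ τ).1 0 + (γ τ).2 0 * (γ τ).2 0 := by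
    funext τ; simp only [rho]; ring
  rw [hf]
  refine key.congr_deriv ?_
  rw [← W.lie_rho0]
  ring

/-- Along a solution, `ρ₁` obeys `ρ̇₁ = quotRho1(r)`. -/
theorem hasDerivWithinAt_rho1 (hγ : HasDerivWithinAt γ (W.field (γ t)) s t) :
    HasDerivWithinAt (fun τ => rho (γ τ) 1)
      (W.quotRho1 (rho (γ t) 0) (rho (γ t) 1) (xi (γ t) 0 1) (zeta (γ t) 0 1)) s t := by
  have key : HasDerivWithinAt (fun τ => (γ τ).1 1 * (γ τ).1 1 + (γ τ).2 1 * (γ τ).2 1)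
      (W.dv₁ (γ t) 1 * (γ t).1 1 + (γ t).1 1 * W.dv₁ (γ t) 1
        + (W.dv₂ (γ t) 1 * (γ t).2 1 + (γ t).2 1 * W.dv₂ (γ t) 1)) s t :=
    ((W.hasDerivWithinAt_fst hγ 1).mul (W.hasDerivWithinAt_fst hγ 1)).add
      ((W.hasDerivWithinAt_snd hγ 1).mul (W.hasDerivWithinAt_snd hγ 1))
  have hf : (fun τ => rho (γ τ) 1) = fun τ => (γ τ).1 1 * (γ τ).1 1 + (γ τ).2 1 * (γ τ).2 1 := by
    funext τ; simp only [rho]; ring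
  rw [hf]
  refine key.congr_deriv ?_
  rw [← W.lie_rho1]
  ring

/-- Along a solution, `ξ` obeys `ξ̇ = quotXi(r)`. -/
theorem hasDerivWithinAt_xi (hγ : HasDerivWithinAt γ (W.field (γ t)) s t) :
    HasDerivWithinAt (fun τ => xi (γ τ) 0 1)
      (W.quotXi (rho (γ t) 0) (rho (γ t) 1) (xi (γ t) 0 1) (zeta (γ t) 0 1)) s t := by
  have key : HasDerivWithinAt (fun τ => (γ τ).1 0 * (γ τ).1 1 + (γ τ).2 0 * (γ τ).2 1)
      (W.dv₁ (γ t) 0 * (γ t).1 1 + (γ t).1 0 * W.dv₁ (γ t) 1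
        + (W.dv₂ (γ t) 0 * (γ t).2 1 + (γ t).2 0 * W.dv₂ (γ t) 1)) s t :=
    ((W.hasDerivWithinAt_fst hγ 0).mul (W.hasDerivWithinAt_fst hγ 1)).add
      ((W.hasDerivWithinAt_snd hγ 0).mul (W.hasDerivWithinAt_snd hγ 1))
  have hf : (fun τ => xi (γ τ) 0 1) = fun τ => (γ τ).1 0 * (γ τ).1 1 + (γ τ).2 0 * (γ τ).2 1 := by
    funext τ; simp only [xi]
  rw [hf]
  refine key.congr_deriv ?_
  rw [← W.lie_xi]
  ring

/-- Along a solution, `ζ` obeys `ζ̇ = quotZeta(r)`. -/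
theorem hasDerivWithinAt_zeta (hγ : HasDerivWithinAt γ (W.field (γ t)) s t) :
    HasDerivWithinAt (fun τ => zeta (γ τ) 0 1)
      (W.quotZeta (rho (γ t) 0) (rho (γ t) 1) (xi (γ t) 0 1) (zeta (γ t) 0 1)) s t := by
  have key : HasDerivWithinAt (fun τ => (γ τ).1 0 * (γ τ).2 1 - (γ τ).2 0 * (γ τ).1 1)
      (W.dv₁ (γ t) 0 * (γ t).2 1 + (γ t).1 0 * W.dv₂ (γ t) 1
        - (W.dv₂ (γ t) 0 * (γ t).1 1 + (γ t).2 0 * W.dv₁ (γ t) 1)) s t :=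
    ((W.hasDerivWithinAt_fst hγ 0).mul (W.hasDerivWithinAt_snd hγ 1)).sub
      ((W.hasDerivWithinAt_snd hγ 0).mul (W.hasDerivWithinAt_fst hγ 1))
  have hf : (fun τ => zeta (γ τ) 0 1) = fun τ => (γ τ).1 0 * (γ τ).2 1 - (γ τ).2 0 * (γ τ).1 1 := by
    funext τ; simp only [zeta]
  rw [hf]
  refine key.congr_deriv ?_
  rw [← W.lie_zeta]
  ring

/-- **Chain rule.** Along every solution `γ` of the reduced dVOC network `f^s_v̂` (tree convention:
`HasDerivWithinAt γ (field (γ t)) s t`), the invariant curve `t ↦ r(t) = invariants (γ t)` satisfies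
`dr/dt = G(r(t))` within `s` — so an SOS Lyapunov certificate for the 4-variable quotient field `G`
on the quadric (TARGET STATEMENT above) is a statement about every solution of the dVOC network
MODEL, modulo the common rotation. MODELLED: MV-6O. -/
theorem hasDerivWithinAt_invariants (hγ : HasDerivWithinAt γ (W.field (γ t)) s t) :
    HasDerivWithinAt (fun τ => invariants (γ τ)) (W.quotField (invariants (γ t))) s t := by
  refine hasDerivWithinAt_pi.2 fun i => ?_
  fin_cases i
  · simpa [invariants, quotField] using W.hasDerivWithinAt_rho0 hγ
  · simpa [invariants, quotField] using W.hasDerivWithinAt_rho1 hγ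
  · simpa [invariants, quotField] using W.hasDerivWithinAt_xi hγ
  · simpa [invariants, quotField] using W.hasDerivWithinAt_zeta hγ

end Descend

/-- Rest points of `f^s_v̂` are mapped to zeros of the quotient field (so the whole `ℛ(θ)`-orbit of a
rest configuration is ONE rest point `r⋆` of `G`). -/
theorem quotField_invariants_eq_zero {v : State 2} (h : W.field v = 0) :
    W.quotField (invariants v) = 0 := by
  have h1 : ∀ k, W.dv₁ v k = 0 := fun k => by
    have := congrArg (fun f => f.1 k) h
    simpa [field] using this
  have h2 : ∀ k, W.dv₂ v k = 0 := fun k => by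
    have := congrArg (fun f => f.2 k) h
    simpa [field] using this
  ext i
  fin_cases i
  · simp [quotField, invariants, ← W.lie_rho0, h1, h2]
  · simp [quotField, invariants, ← W.lie_rho1, h1, h2]
  · simp [quotField, invariants, ← W.lie_xi, h1, h2]
  · simp [quotField, invariants, ← W.lie_zeta, h1, h2]

end TwoConverters

end Summit.Ventures.GridStability.Models.InverterDVOC.DvocNetwork

end
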